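import Summits.BirchSwinnertonDyer.Rank1Residual.X12.CMRungLeaves
import Summits.BirchSwinnertonDyer.Rank1Residual.X12.InertCoreEveryCurve
import Summits.BirchSwinnertonDyer.Rank1Residual.X12.ClassClosureO10RubinEta
import Literature.NumberTheory.EllipticCurves.Rank1Residual.Typed.X12
import HarnessLib

set_option linter.dupNamespace false
set_option autoImplicit false

open scoped Classical

/-!
# CM rung inputs, K8 through the LOWER HALF ON THE TYPE — ROUTE-INDEPENDENT Theorems-side bridge
# (cell bsd-cm, seat bsd-cm-k8i-c2 g3; helper toward stmt-BirchSwinnertonDyer-19223; nothing asserted)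

Companion of `Theorems/CMRungInputs.lean` (p406906). That module proves
`CMRungInputs.cmInertBad_of_inputs : C-cc-1 on (p, I₀*) → off-type residual → p = 3 residual →
print readings → published facts → X12.CMInertBad`, and the route `InertBadSignedBranches` closes the
rung leaf K8 by the one-liner `closes h₁ h₂ h₃ h₅ h₆ := CMRungInputs.cmInertBad_of_inputs …`.

THIS module is the same bridge with the `(C-cc-1, print readings) ↦ BSD_p` step on the type
`(p, I₀*)` REPLACED by the class owner's every-curve Kolyvagin half
(`X12.missingInputAt_of_classX12_of_cmInert_of_lower`, x1b, `p ≥ 11`) resp. the two halves at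
`p ∈ {5, 7}`:

* `cmInertBad_of_lowerHalf_inputs : (∀ p ≥ 5, X12.O10.LowerHalfOnType p I₀*) → (upper half on the
  type at p ∈ {5, 7}) → off-type residual → p = 3 residual → published facts → X12.CMInertBad`;
* `lowerHalfOnType_of_cmInertBad : X12.CMInertBad → ∀ p ≥ 5, X12.O10.LowerHalfOnType p I₀*`
  (no fact);
* `cmInertBad_iff_lowerHalfOnType_of_inputs` — modulo the other four inputs the leaf IS the lower
  half on the type (the exact decomposition a tribunal reads).

It is the ROUTE-INDEPENDENT form of k8i-c2 g0's
`Theorems/InertBadSignedBranchesCccOneLawOnTypeIstarZeroLeafViaLowerHalf.lean` (p418892), whose module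
imports the route file `Theses/InertBadSignedBranches.lean` (through `…OfLowerHalf`) and therefore can
never be cited inside a route's `closes` (import cycle). Here the two residual conjuncts enter as
their item BODIES, verbatim (`InertBadOffType` = stmt-19224, `InertBadAtThree` = stmt-19225), exactly
as in `CMRungInputs`; the imports are `Rank1Residual/X12/*` and `Literature/*` only. Planner
bsd-cm-plan g14, `HOME/bsd-cm-plan/g14/repair/K8/EDIT-CMD.md` STEP 4, names this file as the
prerequisite of the contingent re-line of the attacked crux to the five-class form
`∀ p ≥ 5, LowerHalfOnType p (.Istar 0)` (D79 (2)); a route edited that way would close by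
`closes hlow hup h₂ h₃ hF := CMRungInputsLowerHalf.cmInertBad_of_lowerHalf_inputs hlow hup h₂ h₃ hF`.

No `p`-adic `L`-function, no signed reading (item 19226), no C-cc-1 enters. HONEST LABEL:
CONDITIONAL on displayed hypotheses (x1b's typed class target `LowerHalfOnType` (`@[conjecture]`,
label OBJECT), the Kolyvagin half at `p ∈ {5, 7}` on the type — the Manin datum, published only at
`p ≥ 11` —, the two residual conjuncts, eleven published named facts BY NAME); no `def`, no named
fact minted, nothing booked; the leaf K8, the crux 19223 and O10 stay OPEN. BSD is not proved by
any of this. [cite: EdixhovenManin1991, Thm. 3] [cite: MatarNekovar2019, Thm. 0.3 and §0.11]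
[cite: BurungaleFlach2024, Thm. 1.1 and Cor. 2] [cite: Miller2011LMS, §1 and Def. 1.1]
-/

namespace Summit.BirchSwinnertonDyer.BirchSwinnertonDyer.Rank1Residual.CMRungInputsLowerHalf

open Literature.NumberTheory.EllipticCurves
open Literature.NumberTheory.EllipticCurves.ModularForms
open Literature.NumberTheory.EllipticCurves.Rank1Residual
open Literature.NumberTheory.EllipticCurves.Rank1Residual.Typed
open Summit.BirchSwinnertonDyer.Rank1Residual
open Summit.BirchSwinnertonDyer.Rank1Residual.X12.O10

/-- From `p` prime, `p ≠ 2`, `p ≠ 3`: `5 ≤ p`. [folklore] -/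
theorem five_le_of_prime_of_ne_two_of_ne_three {p : ℕ} (hp : p.Prime) (hp2 : p ≠ 2) (hp3 : p ≠ 3) :
    5 ≤ p := by
  by_contra hlt
  have hlt' : p < 5 := Nat.lt_of_not_le hlt
  interval_cases p
  · exact Nat.not_prime_zero hp
  · exact Nat.not_prime_one hp
  · exact hp2 rfl
  · exact hp3 rfl
  · exact absurd hp (by decide)

/-- **K8 through the lower half on the type (ROUTE-INDEPENDENT bridge).** The lower half
`ord_p #Ш_an ≤ ord_p #Ш` on the signed local type `(p, I₀*)` at every `p ≥ 5` (x1b's typed class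
target `X12.O10.LowerHalfOnType p (.Istar 0)`), the upper (Kolyvagin) half on the type at
`p ∈ {5, 7}` (the Manin datum; published at `p ≥ 11` only), the two residual conjuncts of the rung
(off the type at `p ≥ 5`; `p = 3`) as their item BODIES, and the eleven published named facts of the
class owner's every-curve Kolyvagin half give the rung leaf K8 `X12.CMInertBad`. Case split as in
`CMRungInputs.cmInertBad_of_inputs`: `p = 3` ↦ `h₃`; `p ≥ 5` on the type ↦
`X12.missingInputAt_of_classX12_of_cmInert_of_lower` (`7 < p`) / `missingPPartAt_of_lower_of_upper`
(`p ∈ {5, 7}`); off the type ↦ `h₂`. CONDITIONAL; nothing booked.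
[cite: EdixhovenManin1991, Thm. 3] [cite: MatarNekovar2019, Thm. 0.3 and §0.11]
[cite: BurungaleFlach2024, Thm. 1.1 and Cor. 2] [cite: Miller2011LMS, §1 and Def. 1.1] -/
theorem cmInertBad_of_lowerHalf_inputs
(hlow : ∀ (p : ℕ) [Fact p.Prime], 5 ≤ p →
      Summit.BirchSwinnertonDyer.Rank1Residual.X12.O10.LowerHalfOnType p (.Istar 0))
(hup : ∀ (p : ℕ) [Fact p.Prime], p = 5 ∨ p = 7 → ∀ (W : WeierstrassCurve ℚ) [W.IsElliptic]
      [W.IsGloballyMinimal], Summit.BirchSwinnertonDyer.Rank1Residual.X12.O10.HasSignedLocalType W p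
      (.Istar 0) → W.analyticRank = 1 →
      Literature.NumberTheory.EllipticCurves.Rank1Residual.Typed.MissingUpperBoundAt W p)
(h₂ : ∀ (W : WeierstrassCurve ℚ) [W.IsElliptic] [W.IsGloballyMinimal] (p : ℕ) [Fact p.Prime],
      W.HasCM → W.analyticRank = 1 → Literature.NumberTheory.EllipticCurves.Rank1Residual.CMInert W
      p → ¬ Literature.NumberTheory.EllipticCurves.Rank1Residual.Good W p → 5 ≤ p → ¬
      Summit.BirchSwinnertonDyer.Rank1Residual.X12.O10.HasSignedLocalType W p (.Istar 0) →
      Literature.NumberTheory.EllipticCurves.Rank1Residual.Typed.X12.MissingInputAt W p)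
(h₃ : ∀ (W : WeierstrassCurve ℚ) [W.IsElliptic] [W.IsGloballyMinimal] [Fact (Nat.Prime 3)], W.HasCM
      → W.analyticRank = 1 → Literature.NumberTheory.EllipticCurves.Rank1Residual.CMInert W 3 → ¬
      Literature.NumberTheory.EllipticCurves.Rank1Residual.Good W 3 →
      Literature.NumberTheory.EllipticCurves.Rank1Residual.Typed.X12.MissingInputAt W 3)
(hF : (∀ (N : ℕ) [NeZero N] (W : WeierstrassCurve ℚ) (K : Type) [Field K] [NumberField K],
      Literature.NumberTheory.EllipticCurves.gross_zagier N W K) ∧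
      (∀ (N : ℕ) [NeZero N] (W : WeierstrassCurve ℚ) (K : Type) [Field K] [NumberField K],
      Literature.NumberTheory.EllipticCurves.kolyvagin N W K) ∧
      (∀ (N : ℕ) [NeZero N] (W : WeierstrassCurve ℚ) (K : Type) [Field K] [NumberField K],
      Literature.NumberTheory.EllipticCurves.MatarNekovar2019.thm03_padicValNat_card_sha_le_of_irreducible
      N W K) ∧
      Literature.NumberTheory.EllipticCurves.rank_eq_analyticRank_of_analyticRank_le_one ∧
      WeierstrassCurve.hasEntireLFunction_rat ∧
      Literature.NumberTheory.EllipticCurves.ModularForms.exists_isNewformOf ∧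
      Literature.NumberTheory.EllipticCurves.friedbergHoffstein_exists_heegnerField_split_twist_ne_zero ∧
      Literature.NumberTheory.EllipticCurves.bsdTriple_of_hasCM_of_L_one_ne_zero ∧
      Literature.NumberTheory.EllipticCurves.ModularForms.edixhoven_not_dvd_maninConstant_of_not_potentiallyGoodOrdinary ∧
      Literature.NumberTheory.EllipticCurves.deuring_not_hasUnitRootAt_of_hasCM_of_not_cmSplit ∧
      WeierstrassCurve.bsdRHS_eq_of_isIsogenous) :
    Summit.BirchSwinnertonDyer.Rank1Residual.X12.CMInertBad := by
  obtain ⟨hGZ, hKo, hMN, hGZK, hmod, hnf, hFH, hCM8, hEdx, hDeu, hCassels⟩ := hF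
  intro W _ _ p _ hCM hr hp2 hin hbad
  have hp : p.Prime := Fact.out
  by_cases h3 : p = 3
  · subst h3
    exact h₃ W hCM hr hin hbad
  · have hp5 : 5 ≤ p := five_le_of_prime_of_ne_two_of_ne_three hp hp2 h3
    by_cases hT : HasSignedLocalType W p (.Istar 0)
    · have hlo : MissingLowerBoundAt W p := hlow p hp5 W hT hr
      by_cases hp7 : 7 < p
      · exact X12.missingInputAt_of_classX12_of_cmInert_of_lower hGZ hKo hMN hGZK hmod hnf hFH hCM8
          hEdx hDeu hCassels W p (classX12_of_hasSignedLocalType W p hT hr) hp7 hT.2.1.1 hT.2.1.2 hlo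
      · have h57 : p = 5 ∨ p = 7 := by
          have hle : p ≤ 7 := Nat.le_of_not_lt hp7
          have h6 : p ≠ 6 := by
            rintro rfl
            exact absurd hp (by norm_num)
          omega
        exact fun _ ↦ missingPPartAt_of_lower_of_upper W p hlo (hup p h57 W hT hr)
    · exact h₂ W p hCM hr hin hbad hp5 hT

/-- **Conversely, the leaf gives the lower half on the type at every `p ≥ 5`** (`p ≠ 2`; `p` inert,
hence not split, so `X12.MissingInputAt` is the whole `MissingPPartAt`, whose lower half is read off).
Unfolding; no fact; nothing booked. [cite: Miller2011LMS, §1 and Def. 1.1] -/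
theorem lowerHalfOnType_of_cmInertBad
    (hleaf : Summit.BirchSwinnertonDyer.Rank1Residual.X12.CMInertBad) (p : ℕ) [Fact p.Prime]
    (hp5 : 5 ≤ p) : Summit.BirchSwinnertonDyer.Rank1Residual.X12.O10.LowerHalfOnType p (.Istar 0) := by
  intro W _ _ hT hr
  have hp2 : p ≠ 2 := by omega
  have hmiss : X12.MissingInputAt W p := hleaf W p hT.1 hr hp2 hT.2.1 hT.2.2.1
  exact (lower_and_upper_of_missingPPartAt W p (hmiss fun h ↦ hT.2.1.2 h.2)).1

/-- **Exact decomposition (for the tribunal record).** Modulo the upper half on the type at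
`p ∈ {5, 7}`, the two residual conjuncts and the eleven published facts, the rung leaf K8
`X12.CMInertBad` is EQUIVALENT to the lower half on the type `(p, I₀*)` at every `p ≥ 5`.
Bookkeeping over the two theorems above; nothing booked. [cite: EdixhovenManin1991, Thm. 3]
[cite: MatarNekovar2019, Thm. 0.3 and §0.11] [cite: Miller2011LMS, §1 and Def. 1.1] -/
theorem cmInertBad_iff_lowerHalfOnType_of_inputs
(hup : ∀ (p : ℕ) [Fact p.Prime], p = 5 ∨ p = 7 → ∀ (W : WeierstrassCurve ℚ) [W.IsElliptic]
      [W.IsGloballyMinimal], Summit.BirchSwinnertonDyer.Rank1Residual.X12.O10.HasSignedLocalType W p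
      (.Istar 0) → W.analyticRank = 1 →
      Literature.NumberTheory.EllipticCurves.Rank1Residual.Typed.MissingUpperBoundAt W p)
(h₂ : ∀ (W : WeierstrassCurve ℚ) [W.IsElliptic] [W.IsGloballyMinimal] (p : ℕ) [Fact p.Prime],
      W.HasCM → W.analyticRank = 1 → Literature.NumberTheory.EllipticCurves.Rank1Residual.CMInert W
      p → ¬ Literature.NumberTheory.EllipticCurves.Rank1Residual.Good W p → 5 ≤ p → ¬
      Summit.BirchSwinnertonDyer.Rank1Residual.X12.O10.HasSignedLocalType W p (.Istar 0) →
      Literature.NumberTheory.EllipticCurves.Rank1Residual.Typed.X12.MissingInputAt W p)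
(h₃ : ∀ (W : WeierstrassCurve ℚ) [W.IsElliptic] [W.IsGloballyMinimal] [Fact (Nat.Prime 3)], W.HasCM
      → W.analyticRank = 1 → Literature.NumberTheory.EllipticCurves.Rank1Residual.CMInert W 3 → ¬
      Literature.NumberTheory.EllipticCurves.Rank1Residual.Good W 3 →
      Literature.NumberTheory.EllipticCurves.Rank1Residual.Typed.X12.MissingInputAt W 3)
(hF : (∀ (N : ℕ) [NeZero N] (W : WeierstrassCurve ℚ) (K : Type) [Field K] [NumberField K],
      Literature.NumberTheory.EllipticCurves.gross_zagier N W K) ∧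
      (∀ (N : ℕ) [NeZero N] (W : WeierstrassCurve ℚ) (K : Type) [Field K] [NumberField K],
      Literature.NumberTheory.EllipticCurves.kolyvagin N W K) ∧
      (∀ (N : ℕ) [NeZero N] (W : WeierstrassCurve ℚ) (K : Type) [Field K] [NumberField K],
      Literature.NumberTheory.EllipticCurves.MatarNekovar2019.thm03_padicValNat_card_sha_le_of_irreducible
      N W K) ∧
      Literature.NumberTheory.EllipticCurves.rank_eq_analyticRank_of_analyticRank_le_one ∧
      WeierstrassCurve.hasEntireLFunction_rat ∧
      Literature.NumberTheory.EllipticCurves.ModularForms.exists_isNewformOf ∧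
      Literature.NumberTheory.EllipticCurves.friedbergHoffstein_exists_heegnerField_split_twist_ne_zero ∧
      Literature.NumberTheory.EllipticCurves.bsdTriple_of_hasCM_of_L_one_ne_zero ∧
      Literature.NumberTheory.EllipticCurves.ModularForms.edixhoven_not_dvd_maninConstant_of_not_potentiallyGoodOrdinary ∧
      Literature.NumberTheory.EllipticCurves.deuring_not_hasUnitRootAt_of_hasCM_of_not_cmSplit ∧
      WeierstrassCurve.bsdRHS_eq_of_isIsogenous) :
    Summit.BirchSwinnertonDyer.Rank1Residual.X12.CMInertBad ↔
      ∀ (p : ℕ) [Fact p.Prime], 5 ≤ p →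
        Summit.BirchSwinnertonDyer.Rank1Residual.X12.O10.LowerHalfOnType p (.Istar 0) :=
  ⟨fun hleaf p _ hp5 ↦ lowerHalfOnType_of_cmInertBad hleaf p hp5,
    fun hlow ↦ cmInertBad_of_lowerHalf_inputs hlow hup h₂ h₃ hF⟩

end Summit.BirchSwinnertonDyer.BirchSwinnertonDyer.Rank1Residual.CMRungInputsLowerHalf
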